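import Summits.NavierStokesRegularity.NavierStokesRegularity.Theorems.UnthreadedDoorCellFluxDefs
import Summits.NavierStokesRegularity.NavierStokesRegularity.Theorems.UnthreadedDoorNetFluxNearCentreFlux
import Summits.NavierStokesRegularity.NavierStokesRegularity.Theorems.UnthreadedDoorNetFluxGrowthCap
import HarnessLib

/-!
# Route `UnthreadedDoor`, crux `PoloidalLiouville` (stmt-NavierStokesRegularity-1222), WALL W1 — crux idea «cell-flux»
# (ns-idea-14): Σ-0bR₁ `ClusterFluxNearCentreCap`, the NEAR-CENTRE GROWTH CAP of the cluster flux (repair of Σ-0b)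

Support file (theorems only; `--supports stmt-NavierStokesRegularity-1222 --as helper`).  Σ-0b `ClusterFluxNearCentre` of the
Defs twin (`UnthreadedDoorCellFluxDefs`, p-landed) is FALSE AS TYPED (ns-qj-p1 g7's dipole witness `T = ⟪e,x⟫/‖x‖²`: one cell,
`clusterFlux ≡ 2`; the statement has no vorticity binder).  The repair prepends NF-6's binder block — `v` smooth on the window,
the link `curl v(t) = ∇T(t) × (x − x₀)` (so `ω(t, x₀) = 0` and `‖ω(t, x)‖ ≤ L‖x − x₀‖` near the centre on `[t₁, t₂]`) — and a
DENSE near-centre cell-count hypothesis `Icc t₁ t₂ ×ˢ Ioo 0 1 ⊆ closure {(t,a) | finitely many cells ∧ #cells ≤ N₀}`.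

* `clusterFlux_le_of_cellCount` — at ONE good point `(t, a)` (finitely many cells, `≤ N₀` of them): Σ-0a `ClusterFluxLeVorticity`
  (by name, as a hypothesis `hS0a : ClusterFluxLeVorticity` until ns-qj-p1's proof has an olean) + the rule's count clause +
  `‖ω(t,·)‖ ≤ L a` on `S_a` ⇒ `clusterFlux (T t) a (𝒞 t a) ≤ N₀ · π · L · a²`.
* `ClusterFluxNearCentreCap : Prop` — Σ-0bR₁ of `Cruxes/PoloidalLiouville/CellFluxSketch.lean` v1.2.8 (custodian ns-idea-14 g12,
  commit f9d4531503f3, l.644–654), body VERBATIM (typed here rather than appended to the shared Defs twin `UnthreadedDoorCellFluxDefs`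
  so that no landed CellFlux module is invalidated on the farm; the sketch wires `stub_clusterFluxNearCentreCap` to the decls below).
* ★ `clusterFlux_nearCentre_cap` — the GROWTH CAP (first conjunct of Σ-0b's conclusion) for every admissible rule:
  `∃ κ ≥ 0, ∀ t ∈ [t₁,t₂], ∀ a ∈ ]0,1[, clusterFlux (T t) a (𝒞 t a) ≤ κ a²`, `κ = N₀ π L`; the dense good set
  is upgraded to every `(t, a)` by the JOINT CONTINUITY of the cluster flux (the third clause of `AdmissibleRule`) via
  `le_on_closure` on a box whose closure stays inside the window.
* ★ `clusterFluxNearCentreCap_of : ClusterFluxLeVorticity → ClusterFluxNearCentreCap` — Σ-0bR₁ BY NAME modulo Σ-0a (ns-qj-p1 g7's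
  `CellFlux.clusterFluxLeVorticity`, p717414; the one-liner `clusterFluxNearCentreCap_of clusterFluxLeVorticity` closes the stub once
  that olean is on the farm).

HONEST SCOPE: the two LIPSCHITZ conjuncts of Σ-0b's conclusion (in `r` on `]0,a₀[`, in `t` on `[t₁,t₂]`) are NOT proved here and do
NOT follow from Σ-0a + NF-6 `nearCentreFlux` by bookkeeping (differences of the cluster flux compare class oscillations over two
different partitions; NF-6's Lipschitz bounds are about the unclustered `netFlux = a · osc_{S_a}`).  They are statements about the
event structure of admissible rules and stay with the custodian (ns-idea-14) as a separate stub.  Nothing here touches NS regularity;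
⟨1222⟩, W1 and the line's rung stay OPEN.
-/

noncomputable section

-- the summit and its single sub-problem share the name (CONVENTIONS §1)
set_option linter.dupNamespace false

open Set Function Filter Topology InnerProductSpace MeasureTheory
open scoped RealInnerProductSpace ContDiff

namespace Summit.NavierStokesRegularity.NavierStokesRegularity.Theorems.PoloidalLiouville.CellFlux

open Summit.NavierStokesRegularity.NavierStokesRegularity.Theorems.PoloidalLiouville.NetFlux
  (E3 netFlux contDiff_slice_of_window contDiffOn_slice_compl exists_bound_fderiv_curl cross_gradient_self_center
   norm_curl_le_mul_of_fderiv_le)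
open Literature.Analysis Literature.Analysis.FluidPDE

variable {v : ℝ → E3 → E3} {T P : ℝ → E3 → ℝ} {V : ℝ → ℝ} {x₀ : E3} {t₀ t₁ t₂ : ℝ}

/-- **The cap at one good point.**  Σ-0a (as a hypothesis), a slice `v t ∈ C²` with `curl (v t) = ∇(T t) × (· − x₀)`,
`‖D curl (v t)‖ ≤ L` on the closed unit ball about `x₀`, a radius `0 < a ≤ 1` carrying finitely many cells, at most `N₀` of them, and a
cluster partition `𝒦` with at most as many classes as cells: `clusterFlux (T t) a 𝒦 ≤ N₀ · (π · L) · a²`. -/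
theorem clusterFlux_le_of_cellCount (hS0a : ClusterFluxLeVorticity) {u : E3 → E3} {f : E3 → ℝ} {L a : ℝ} {N₀ : ℕ}
    {𝒦 : Set (Set E3)} (hu : ContDiff ℝ 2 u) (hf : ContDiffOn ℝ 1 f ({x₀}ᶜ : Set E3))
    (hrep : ∀ x, curl u x = cross (gradient f x) (x - x₀)) (hL0 : 0 ≤ L)
    (hL : ∀ x ∈ Metric.closedBall x₀ 1, ‖fderiv ℝ (curl u) x‖ ≤ L) (ha : 0 < a) (ha1 : a ≤ 1)
    (h𝒦 : IsClusterPartition f x₀ a 𝒦) (hcount : 𝒦.ncard ≤ N₀) :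
    clusterFlux f a 𝒦 ≤ (N₀ : ℝ) * (Real.pi * L) * a ^ 2 := by
  -- `‖ω‖ ≤ L a` on the sphere
  have hK : ∀ x ∈ Metric.sphere x₀ a, ‖curl u x‖ ≤ L * a := by
    intro x hx
    have hxb : x ∈ Metric.closedBall x₀ 1 :=
      Metric.mem_closedBall.2 ((Metric.mem_sphere.1 hx).le.trans ha1)
    have h := norm_curl_le_mul_of_fderiv_le hu (cross_gradient_self_center hrep) hL hxb
    rwa [← dist_eq_norm, Metric.mem_sphere.1 hx] at h
  have h1 := hS0a u x₀ f a (L * a) 𝒦 ha (hu.of_le (by norm_num)) hf hrep hK h𝒦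
  have hπ : 0 ≤ Real.pi * a * (L * a) := by positivity
  calc clusterFlux f a 𝒦 ≤ (𝒦.ncard : ℝ) * (Real.pi * a * (L * a)) := h1
    _ ≤ (N₀ : ℝ) * (Real.pi * a * (L * a)) := by
        exact mul_le_mul_of_nonneg_right (by exact_mod_cast hcount) hπ
    _ = (N₀ : ℝ) * (Real.pi * L) * a ^ 2 := by ring

/-- ★ **Σ-0bR, GROWTH CAP: near-centre control of the cluster flux of an admissible rule** (first conjunct of Σ-0b's conclusion,
under NF-6's binder block and a dense cell-count bound).  Let `v` be smooth on the window `]t₀,0[ × ℝ³`, `T` smooth off the centre,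
`curl v(t) = ∇T(t) × (x − x₀)` on the window, `t₀ < t₁ ≤ t₂ < 0`, and suppose the good set
`{(t,a) | finitely many cells on S_a(x₀) for T(t), at most N₀}` is dense in `[t₁,t₂] × ]0,1[`.  Then for every admissible rule `𝒞`
there is `κ ≥ 0` (`κ = N₀ π L`, `L = sup ‖D_x curl v‖` over a slightly larger time interval times the closed unit ball) with
`clusterFlux (T t) a (𝒞 t a) ≤ κ a²` for all `t ∈ [t₁,t₂]`, `a ∈ ]0,1[`.  (Σ-0a = `ClusterFluxLeVorticity` enters as a hypothesis; it is
ns-qj-p1's theorem `CellFlux.clusterFluxLeVorticity`.) -/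
theorem clusterFlux_nearCentre_cap (hS0a : ClusterFluxLeVorticity) (v : ℝ → E3 → E3) (x₀ : E3) (T P : ℝ → E3 → ℝ)
    (V : ℝ → ℝ) (t₀ t₁ t₂ : ℝ) (h01 : t₀ < t₁) (h12 : t₁ ≤ t₂) (h20 : t₂ < 0)
    (hv : ContDiffOn ℝ (⊤ : ℕ∞) (uncurry v) (Ioo t₀ 0 ×ˢ (univ : Set E3)))
    (hT : ContDiffOn ℝ (⊤ : ℕ∞) (uncurry T) (Ioo t₀ 0 ×ˢ ({x₀}ᶜ : Set E3)))
    (hlink : ∀ t ∈ Ioo t₀ 0, ∀ x, curl (v t) x = cross (gradient (T t) x) (x - x₀))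
    (N₀ : ℕ)
    (hdense : Icc t₁ t₂ ×ˢ Ioo (0 : ℝ) 1 ⊆
      closure {p : ℝ × ℝ | p.1 ∈ Ioo t₀ 0 ∧ 0 < p.2 ∧ (cellSet (T p.1) x₀ p.2).Finite ∧
        (cellSet (T p.1) x₀ p.2).ncard ≤ N₀})
    (𝒞 : ℝ → ℝ → Set (Set E3)) (h𝒞 : AdmissibleRule x₀ T P V t₀ 𝒞) :
    ∃ κ : ℝ, 0 ≤ κ ∧ ∀ t ∈ Icc t₁ t₂, ∀ a ∈ Ioo (0 : ℝ) 1,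
      clusterFlux (T t) a (𝒞 t a) ≤ κ * a ^ 2 := by
  -- the constant `L` on a slightly larger time interval
  set t₁' : ℝ := (t₀ + t₁) / 2 with ht₁'
  set t₂' : ℝ := t₂ / 2 with ht₂'
  have h01' : t₀ < t₁' := by rw [ht₁']; linarith
  have h1'1 : t₁' < t₁ := by rw [ht₁']; linarith
  have h22' : t₂ < t₂' := by rw [ht₂']; linarith
  have h2'0 : t₂' < 0 := by rw [ht₂']; linarith
  obtain ⟨L, hL0, hL⟩ := exists_bound_fderiv_curl (t₁ := t₁') (t₂ := t₂') x₀ hv h01' h2'0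
  obtain ⟨hpart, -, hcont, hcnt⟩ := h𝒞
  refine ⟨(N₀ : ℝ) * (Real.pi * L), by positivity, fun t ht a ha => ?_⟩
  have ha0 : 0 < a := ha.1
  have ha1 : a < 1 := ha.2
  -- the open box around `(t, a)` whose closure stays in the window
  set U : Set (ℝ × ℝ) := Ioo t₁' t₂' ×ˢ Ioo (a / 2) 1 with hU
  have hUo : IsOpen U := isOpen_Ioo.prod isOpen_Ioo
  have hmemU : ((t, a) : ℝ × ℝ) ∈ U := ⟨⟨h1'1.trans_le ht.1, lt_of_le_of_lt ht.2 h22'⟩, ⟨by linarith, ha1⟩⟩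
  set S : Set (ℝ × ℝ) := {p : ℝ × ℝ | p.1 ∈ Ioo t₀ 0 ∧ 0 < p.2 ∧ (cellSet (T p.1) x₀ p.2).Finite ∧
      (cellSet (T p.1) x₀ p.2).ncard ≤ N₀} with hS
  have hcl : ((t, a) : ℝ × ℝ) ∈ closure (U ∩ S) :=
    hUo.inter_closure ⟨hmemU, hdense ⟨ht, ⟨ha0, ha1⟩⟩⟩
  -- the window contains the closure of the box
  have h12' : t₁' < t₂' := by linarith [ht.1, ht.2]
  have hUW : closure (U ∩ S) ⊆ Ioo t₀ 0 ×ˢ Ioi (0 : ℝ) := by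
    refine (closure_mono inter_subset_left).trans ?_
    have hcU : closure U = Icc t₁' t₂' ×ˢ Icc (a / 2) 1 := by
      rw [hU, closure_prod_eq, closure_Ioo h12'.ne, closure_Ioo (by linarith : a / 2 ≠ 1)]
    rw [hcU]
    exact prod_mono (Icc_subset_Ioo h01' h2'0) fun r hr => lt_of_lt_of_le (half_pos ha0) hr.1
  -- the cap on the good points of the box
  have hgood : ∀ q ∈ U ∩ S, clusterFlux (T q.1) q.2 (𝒞 q.1 q.2) ≤ (N₀ : ℝ) * (Real.pi * L) * q.2 ^ 2 := by
    rintro ⟨s, r⟩ ⟨⟨hs, hr⟩, -, -, hfin, hN⟩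
    have hsW : s ∈ Ioo t₀ 0 := ⟨h01'.trans hs.1, hs.2.trans h2'0⟩
    have hr0 : 0 < r := lt_trans (by linarith) hr.1
    have hvs : ContDiff ℝ 2 (v s) := (contDiff_slice_of_window hv hsW).of_le (WithTop.coe_le_coe.2 le_top)
    have hTs : ContDiffOn ℝ 1 (T s) ({x₀}ᶜ) := (contDiffOn_slice_compl hT hsW).of_le (WithTop.coe_le_coe.2 le_top)
    have hLs : ∀ x ∈ Metric.closedBall x₀ 1, ‖fderiv ℝ (curl (v s)) x‖ ≤ L :=
      fun x hx => hL s ⟨hs.1.le, hs.2.le⟩ x hx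
    exact clusterFlux_le_of_cellCount hS0a hvs hTs (hlink s hsW) hL0 hLs hr0 hr.2.le (hpart s hsW r hr0)
      ((hcnt s hsW r hr0 hfin).trans hN)
  -- continuity of both sides on the closure, and `le_on_closure`
  have hF : ContinuousOn (fun q : ℝ × ℝ => clusterFlux (T q.1) q.2 (𝒞 q.1 q.2)) (closure (U ∩ S)) := hcont.mono hUW
  have hG : ContinuousOn (fun q : ℝ × ℝ => (N₀ : ℝ) * (Real.pi * L) * q.2 ^ 2) (closure (U ∩ S)) := by
    fun_prop
  exact le_on_closure hgood hF hG hcl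

/-- **Σ-0bR₁ `ClusterFluxNearCentreCap` (support, S — conjunct (i) of Σ-0b′ `ClusterFluxNearCentreLinked` over the same binders): the
quadratic GROWTH CAP of the cluster flux near the centre.**  Body VERBATIM from `Cruxes/PoloidalLiouville/CellFluxSketch.lean` v1.2.8
(ns-idea-14 g12, commit f9d4531503f3): NF-6's binder block (`v` smooth on the window slab, `T` smooth off the centre, the link
`curl (v t) = ∇(T t) × (· − x₀)`), a DENSE near-centre cell-count bound `≤ N₀`, and for every admissible rule `𝒞`:
`∃ κ ≥ 0, ∀ t ∈ [t₁,t₂], ∀ a ∈ ]0,1[, clusterFlux (T t) a (𝒞 t a) ≤ κ a²`.  (Σ-0b `ClusterFluxNearCentre` of the Defs twin is FALSE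
as typed — dipole witness, ns-qj-p1 g7 — and stays there as the recorded negative edge; the Lipschitz conjuncts are the separate OPEN
stub Σ-0bR₂ `ClusterFluxNearCentreLipschitz` of the sketch.) -/
def ClusterFluxNearCentreCap : Prop :=
  ∀ (v : ℝ → E3 → E3) (x₀ : E3) (T P : ℝ → E3 → ℝ) (V : ℝ → ℝ) (N₀ : ℕ) (t₀ t₁ t₂ : ℝ), t₀ < t₁ → t₁ ≤ t₂ → t₂ < 0 →
    ContDiffOn ℝ (⊤ : ℕ∞) (uncurry v) (Ioo t₀ 0 ×ˢ (univ : Set E3)) →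
    ContDiffOn ℝ (⊤ : ℕ∞) (uncurry T) (Ioo t₀ 0 ×ˢ ({x₀}ᶜ : Set E3)) →
    (∀ t ∈ Ioo t₀ 0, ∀ x, curl (v t) x = cross (gradient (T t) x) (x - x₀)) →
    Icc t₁ t₂ ×ˢ Ioo (0 : ℝ) 1 ⊆ closure {p : ℝ × ℝ | p.1 ∈ Ioo t₀ 0 ∧ 0 < p.2 ∧
        (cellSet (T p.1) x₀ p.2).Finite ∧ (cellSet (T p.1) x₀ p.2).ncard ≤ N₀} →
    ∀ 𝒞 : ℝ → ℝ → Set (Set E3), AdmissibleRule x₀ T P V t₀ 𝒞 →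
    ∃ κ : ℝ, 0 ≤ κ ∧ ∀ t ∈ Icc t₁ t₂, ∀ a ∈ Ioo (0 : ℝ) 1, clusterFlux (T t) a (𝒞 t a) ≤ κ * a ^ 2

/-- ★ **Σ-0bR₁ BY NAME, modulo Σ-0a**: `ClusterFluxLeVorticity → ClusterFluxNearCentreCap` (binder bookkeeping over
`clusterFlux_nearCentre_cap`).  With ns-qj-p1's `CellFlux.clusterFluxLeVorticity : ClusterFluxLeVorticity` (p717414) the stub
`stub_clusterFluxNearCentreCap` of the sketch closes as `clusterFluxNearCentreCap_of clusterFluxLeVorticity`. -/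
theorem clusterFluxNearCentreCap_of (hS0a : ClusterFluxLeVorticity) : ClusterFluxNearCentreCap :=
  fun v x₀ T P V N₀ t₀ t₁ t₂ h01 h12 h20 hv hT hlink hdense 𝒞 h𝒞 =>
    clusterFlux_nearCentre_cap hS0a v x₀ T P V t₀ t₁ t₂ h01 h12 h20 hv hT hlink N₀ hdense 𝒞 h𝒞

end Summit.NavierStokesRegularity.NavierStokesRegularity.Theorems.PoloidalLiouville.CellFlux

end
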